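import Summits.Ventures.PercRepro.MSSplitClasses

/-!
# Step 3 (δ)–(ε) of Theorem 10.1: the count (★)

proofs/P4-gen9.md §10, Step 3. With the six classes of `MSSplitClasses.lean`, the good family
`G = F \\ F` contains the two PURE halves `pureS = {W ∈ G : W ⊆ A₅ ∪ A₆}` and
`pureT = {W ∈ G : W ⊆ A₃ ∪ A₄}`, which meet exactly in `∅` (`pureS_inter_pureT`), and the REST
`rest = G ∖ (pureS ∪ pureT)`. Marica–Schönheim on the traces (`card_le_card_diffs` +
`diffs_traces_s_subset`) gives `|pureS| ≥ |s| + [A₅ ∉ T]` and `|pureT| ≥ |t| + [A₃ ∉ S]`; with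
`|G| = |F| + 1 = |s| + |t| + 1` this is the count

  (★)  `[A₅ ∉ T] + [A₃ ∉ S] + |rest| ≤ 2`   (`star`).

The rest contains every good set meeting `A₁` or `A₂` (`mem_rest_of_mem_classA1/2`) and every
MIXED good set, one meeting both halves (`mem_rest_of_mixed`); Step 4 exhibits three such sets (or
two and an indicator) in every case but the residual one.
-/

namespace PercRepro.MSTight

open Finset
open scoped FinsetFamily

variable {α : Type*} [DecidableEq α]

section Count

variable {u : Finset α} {F s t : Finset (Finset α)}

/-- Every coordinate of the support lies in one of the six classes. -/
theorem mem_classes (h : CoverHyp u F s t) {r : α} (hr : r ∈ u) :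
    r ∈ classA1 u s t ∨ r ∈ classA2 u s t ∨ r ∈ classA3 u s t ∨ r ∈ classA4 u s t ∨
      r ∈ classA5 u s t ∨ r ∈ classA6 u s t := by
  obtain ⟨hc, -, -⟩ := classes_cover h r hr
  rcases hc with hc | hc | hc | hc
  · by_cases hOt : InNone t r
    · exact Or.inl (mem_classA1.2 ⟨hr, hc, hOt⟩)
    · exact Or.inr (Or.inr (Or.inl (mem_classA3.2 ⟨hr, hc, hOt⟩)))
  · by_cases hIt : InAll t r
    · exact Or.inr (Or.inl (mem_classA2.2 ⟨hr, hc, hIt⟩))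
    · exact Or.inr (Or.inr (Or.inr (Or.inl (mem_classA4.2 ⟨hr, hc, hIt⟩))))
  · by_cases hOs : InNone s r
    · exact Or.inr (Or.inl (mem_classA2.2 ⟨hr, hOs, hc⟩))
    · exact Or.inr (Or.inr (Or.inr (Or.inr (Or.inl (mem_classA5.2 ⟨hr, hc, hOs⟩)))))
  · by_cases hIs : InAll s r
    · exact Or.inl (mem_classA1.2 ⟨hr, hIs, hc⟩)
    · exact Or.inr (Or.inr (Or.inr (Or.inr (Or.inr (mem_classA6.2 ⟨hr, hc, hIs⟩)))))

/-- The two halves `A₅ ∪ A₆` and `A₃ ∪ A₄` are disjoint. -/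
theorem disjoint_halves (h : CoverHyp u F s t) :
    Disjoint (classA5 u s t ∪ classA6 u s t) (classA3 u s t ∪ classA4 u s t) := by
  rw [Finset.disjoint_left]
  intro r hr hr'
  have hru : r ∈ u := by
    rcases Finset.mem_union.1 hr with h5 | h6
    · exact (mem_classA5.1 h5).1
    · exact (mem_classA6.1 h6).1
  obtain ⟨-, h2, h3⟩ := classes_cover h r hru
  rcases Finset.mem_union.1 hr with h5 | h6 <;> rcases Finset.mem_union.1 hr' with h3' | h4
  · exact h2 ⟨(mem_classA3.1 h3').2.1, (mem_classA5.1 h5).2.1⟩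
  · exact (mem_classA4.1 h4).2.2 (mem_classA5.1 h5).2.1
  · exact (mem_classA3.1 h3').2.2 (mem_classA6.1 h6).2.1
  · exact h3 ⟨(mem_classA4.1 h4).2.1, (mem_classA6.1 h6).2.1⟩

/-- `A₁` meets neither half. -/
theorem notMem_halves_of_mem_classA1 (h : CoverHyp u F s t) {r : α} (hr : r ∈ classA1 u s t) :
    r ∉ classA5 u s t ∪ classA6 u s t ∧ r ∉ classA3 u s t ∪ classA4 u s t := by
  obtain ⟨-, hIs, hOt⟩ := mem_classA1.1 hr
  obtain ⟨a, ha⟩ := h.split.ne_s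
  obtain ⟨b, hb⟩ := h.split.ne_t
  constructor
  · intro hr'
    rcases Finset.mem_union.1 hr' with h5 | h6
    · exact hOt b hb ((mem_classA5.1 h5).2.1 b hb)
    · exact (mem_classA6.1 h6).2.2 hIs
  · intro hr'
    rcases Finset.mem_union.1 hr' with h3 | h4
    · exact (mem_classA3.1 h3).2.2 hOt
    · exact (mem_classA4.1 h4).2.1 a ha (hIs a ha)

/-- `A₂` meets neither half. -/
theorem notMem_halves_of_mem_classA2 (h : CoverHyp u F s t) {r : α} (hr : r ∈ classA2 u s t) :
    r ∉ classA5 u s t ∪ classA6 u s t ∧ r ∉ classA3 u s t ∪ classA4 u s t := by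
  rw [classA2_symm (s := t) (t := s)] at hr
  have := notMem_halves_of_mem_classA1 h.symm hr
  rw [classA5_symm, classA6_symm, ← classA5_symm (s := t) (t := s),
    ← classA6_symm (s := t) (t := s)] at this
  exact this.symm

/-- `A₁ ∩ A₂ = ∅`. -/
theorem disjoint_classA1_classA2 (h : CoverHyp u F s t) :
    Disjoint (classA1 u s t) (classA2 u s t) := by
  rw [Finset.disjoint_left]
  intro r h1 h2
  obtain ⟨a, ha⟩ := h.split.ne_s
  exact (mem_classA2.1 h2).2.1 a ha ((mem_classA1.1 h1).2.1 a ha)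

/-- `∅` is a good set. -/
theorem empty_mem_diffs (h : CoverHyp u F s t) : (∅ : Finset α) ∈ F \\ F := by
  obtain ⟨a, ha⟩ := h.split.ne_s
  have haF : a ∈ F := by rw [← h.split.union]; exact Finset.mem_union_left t ha
  exact Finset.mem_diffs.2 ⟨a, haF, a, haF, Finset.sdiff_self a⟩

/-- The pure good sets of the `s`-half `A₅ ∪ A₆`. -/
noncomputable def pureS (u : Finset α) (F s t : Finset (Finset α)) : Finset (Finset α) :=
  (F \\ F).filter fun W => W ⊆ classA5 u s t ∪ classA6 u s t

/-- The pure good sets of the `t`-half `A₃ ∪ A₄`. -/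
noncomputable def pureT (u : Finset α) (F s t : Finset (Finset α)) : Finset (Finset α) :=
  (F \\ F).filter fun W => W ⊆ classA3 u s t ∪ classA4 u s t

/-- The good sets in neither half. -/
noncomputable def rest (u : Finset α) (F s t : Finset (Finset α)) : Finset (Finset α) :=
  (F \\ F) \ (pureS u F s t ∪ pureT u F s t)

/-- Membership in the pure `s`-half. -/
theorem mem_pureS {W : Finset α} :
    W ∈ pureS u F s t ↔ W ∈ F \\ F ∧ W ⊆ classA5 u s t ∪ classA6 u s t := by
  simp [pureS]

/-- Membership in the pure `t`-half. -/
theorem mem_pureT {W : Finset α} :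
    W ∈ pureT u F s t ↔ W ∈ F \\ F ∧ W ⊆ classA3 u s t ∪ classA4 u s t := by
  simp [pureT]

/-- Membership in the rest: a good set contained in neither half. -/
theorem mem_rest {W : Finset α} :
    W ∈ rest u F s t ↔ W ∈ F \\ F ∧ ¬ W ⊆ classA5 u s t ∪ classA6 u s t ∧
      ¬ W ⊆ classA3 u s t ∪ classA4 u s t := by
  simp only [rest, Finset.mem_sdiff, Finset.mem_union, mem_pureS, mem_pureT]
  tauto

/-- (ε) for `s`: `|s| + [A₅ ∉ T] ≤ |pureS|` (Marica–Schönheim on `T ∪ {A₅}`). -/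
theorem card_s_add_le_card_pureS (h : CoverHyp u F s t) :
    s.card + (if classA5 u s t ∈ s.image (fun a => a ∩ (classA5 u s t ∪ classA6 u s t)) then 0
      else 1) ≤ (pureS u F s t).card := by
  have h1 : (insert (classA5 u s t)
      (s.image fun a => a ∩ (classA5 u s t ∪ classA6 u s t))).card ≤ (pureS u F s t).card := by
    refine (Finset.card_le_card_diffs _).trans (Finset.card_le_card ?_)
    intro W hW
    exact mem_pureS.2 (Finset.mem_filter.1 (diffs_traces_s_subset h hW))
  rw [Finset.card_insert_eq_ite, card_traces_s h] at h1
  split_ifs at h1 ⊢ <;> omega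

/-- (ε) for `t`: `|t| + [A₃ ∉ S] ≤ |pureT|`. -/
theorem card_t_add_le_card_pureT (h : CoverHyp u F s t) :
    t.card + (if classA3 u s t ∈ t.image (fun b => b ∩ (classA3 u s t ∪ classA4 u s t)) then 0
      else 1) ≤ (pureT u F s t).card := by
  have h1 : (insert (classA3 u s t)
      (t.image fun b => b ∩ (classA3 u s t ∪ classA4 u s t))).card ≤ (pureT u F s t).card := by
    refine (Finset.card_le_card_diffs _).trans (Finset.card_le_card ?_)
    intro W hW
    exact mem_pureT.2 (Finset.mem_filter.1 (diffs_traces_t_subset h hW))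
  rw [Finset.card_insert_eq_ite, card_traces_t h] at h1
  split_ifs at h1 ⊢ <;> omega

/-- The two pure families meet exactly in `∅`. -/
theorem pureS_inter_pureT (h : CoverHyp u F s t) : pureS u F s t ∩ pureT u F s t = {∅} := by
  ext W
  rw [Finset.mem_inter, mem_pureS, mem_pureT, Finset.mem_singleton]
  constructor
  · rintro ⟨⟨-, hs⟩, ⟨-, ht⟩⟩
    have hW : W ⊆ (classA5 u s t ∪ classA6 u s t) ∩ (classA3 u s t ∪ classA4 u s t) :=
      Finset.subset_inter hs ht
    rw [Finset.disjoint_iff_inter_eq_empty.1 (disjoint_halves h)] at hW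
    exact Finset.subset_empty.1 hW
  · rintro rfl
    exact ⟨⟨empty_mem_diffs h, Finset.empty_subset _⟩, ⟨empty_mem_diffs h, Finset.empty_subset _⟩⟩

/-- **(★)**: `[A₅ ∉ T] + [A₃ ∉ S] + |rest| ≤ 2`. -/
theorem star (h : CoverHyp u F s t) :
    (if classA5 u s t ∈ s.image (fun a => a ∩ (classA5 u s t ∪ classA6 u s t)) then 0 else 1) +
      (if classA3 u s t ∈ t.image (fun b => b ∩ (classA3 u s t ∪ classA4 u s t)) then 0
        else 1) + (rest u F s t).card ≤ 2 := by
  have h1 := card_s_add_le_card_pureS h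
  have h2 := card_t_add_le_card_pureT h
  have h3 := Finset.card_union_add_card_inter (pureS u F s t) (pureT u F s t)
  rw [pureS_inter_pureT h, Finset.card_singleton] at h3
  have h4 : (rest u F s t).card + (pureS u F s t ∪ pureT u F s t).card = (F \\ F).card :=
    Finset.card_sdiff_add_card_eq_card (Finset.union_subset (fun W hW => (mem_pureS.1 hW).1)
      (fun W hW => (mem_pureT.1 hW).1))
  have h5 : F.card = s.card + t.card := by
    rw [← h.split.union]; exact Finset.card_union_of_disjoint h.split.disj
  have h6 := h.exc
  omega

/-- A good set meeting `A₁` is in the rest. -/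
theorem mem_rest_of_mem_classA1 (h : CoverHyp u F s t) {W : Finset α} (hW : W ∈ F \\ F) {r : α}
    (hr : r ∈ classA1 u s t) (hrW : r ∈ W) : W ∈ rest u F s t := by
  obtain ⟨h1, h2⟩ := notMem_halves_of_mem_classA1 h hr
  exact mem_rest.2 ⟨hW, fun hs => h1 (hs hrW), fun ht => h2 (ht hrW)⟩

/-- A good set meeting `A₂` is in the rest. -/
theorem mem_rest_of_mem_classA2 (h : CoverHyp u F s t) {W : Finset α} (hW : W ∈ F \\ F) {r : α}
    (hr : r ∈ classA2 u s t) (hrW : r ∈ W) : W ∈ rest u F s t := by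
  obtain ⟨h1, h2⟩ := notMem_halves_of_mem_classA2 h hr
  exact mem_rest.2 ⟨hW, fun hs => h1 (hs hrW), fun ht => h2 (ht hrW)⟩

/-- A MIXED good set (meeting both halves) is in the rest. -/
theorem mem_rest_of_mixed (h : CoverHyp u F s t) {W : Finset α} (hW : W ∈ F \\ F) {x y : α}
    (hx : x ∈ W) (hxR : x ∈ classA5 u s t ∪ classA6 u s t) (hy : y ∈ W)
    (hyR : y ∈ classA3 u s t ∪ classA4 u s t) : W ∈ rest u F s t := by
  refine mem_rest.2 ⟨hW, fun hs => ?_, fun ht => ?_⟩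
  · exact Finset.disjoint_left.1 (disjoint_halves h) (hs hy) hyR
  · exact Finset.disjoint_left.1 (disjoint_halves h) hxR (ht hx)

end Count

end PercRepro.MSTight
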